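import Literature.MathematicalPhysics.QuantumFieldTheory.Balaban1983to89.B16Sect1WilsonTerms

/-!
# `Balaban1983to89.B16Eq117Expansion` — T. Bałaban, *Large field renormalization. II. Localization, exponentiation,
and bounds for the 𝐑 operation*, Commun. Math. Phys. **122** (1989) 355–392 [Balaban1989LargeFieldII], Sect. 1
p. 360 display **(1.17)** (the expansion of `A(ζ₀, U″_k)` with respect to the function `𝐇″_{k,Z}` of the localization
(1.16)) and p. 362 display **(1.26)** (the splitting `H″_{1,k,Z} = H″_{1,k,X₀} + H″_{X₀,(Ω″˜_{h+1})ᶜ}` of the minimizer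
read off the generalized random-walk expansion of [13]) — the two displays of Sect. 1 whose SKELETON cells still read
«expansion absent» — typed over the vocabulary of `…B16Sect1Backgrounds` ((1.16): `cfgPP`, `cfgPPZ`, `arg116`,
`Repr116`) and `…B16Sect1WilsonTerms` ((1.20): `Sect1Data.Eq120`), with the first equality of (1.17) and the induced
splitting of the linear term of (1.20) PROVED

statement-level skeleton of published theorems with citation tags; proofs where landed; nothing here is a claim about
the Yang–Mills mass gap

PDF held: `paper:balaban1989-cmp122-large-field-ii` (journal page = PDF page + 354); [I] = [Balaban1987RG1],
[IV] = [Balaban1989LargeFieldI], [15] = [Balaban1985Variational], [13] = [Balaban1985BackgroundPropagators].  Every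
quotation below was READ AS AN IMAGE by this seat on the x2 renders
`run/shared/lean/pub/pub-balaban/b2b-balaban-ref1/pages/1989-cmp122-large-field-II/…-p006-x2.png` (p. 360) and
`…-p008-x2.png` (p. 362).

CITATION HEADER / WHAT IS REPRODUCED (mega-formalization `lit-balaban`, reader/typer r13 gen 7; HOME
`run/shared/lean/pub/lit-balaban/`, rows `lit-balaban-r13/ROWS-B16.md` v2.21): SKELETON rows **B16.Eq1.17** (cell
«typed-existing (clause only); expansion absent» — the smallness clause after (1.17) is the tree's
`…B16Suppression.suppression`) and **B16.Eq1.26** (cell «typed-existing (geometry only); expansion absent» — the support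
algebra `Λ ∪ X₀ = Z` is the tree's `…B16Stage3Regions.Lam_union_eq_of_supset`).

WHAT IS HERE.
* §1 — **(1.17)** as a `Prop` over the configurations `U″_k = cfgPP`, `U″_{k,Z} = cfgPPZ` and the chart argument
  `arg116` of (1.16) (`…B16Sect1Backgrounds.Sect1Data`), a representing function `H = 𝐇″_{k,Z}` and EXPLICIT expansion
  functionals at the background `U″_{k,Z}` and weight `ζ₀` — `L A = ⟨DA, ζ₀η⁻² Im ∂U″_{k,Z}⟩` (linear), `Q A A′ =
  ⟨A, Δ(ζ₀)A′⟩` (bilinear), `V₀ = V₀(ζ₀, ·)` — exactly in the style of the gen-4 `Sect1Data.Eq120` (ref-1 F6: every object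
  the display names is an explicit argument); the generic shape `Expansion174` of such a (174)[15]/(2.6)[I]-expansion of
  `A(ζ, ·)` around a base configuration; the FIRST EQUALITY of (1.17) PROVED from the representation (1.16) (`Repr116`)
  by gauge invariance of `A(ζ₀, ·)` (`eq117_first`), and (1.17) PROVED from (1.16) + the (174)[15]-expansion at the
  background `U″_{k,Z}` taken as the printed input (`eq117_of_expansion174`); the p. 360 sentence *"The second term on
  the right-hand side of (1.15) is represented in a similar way … the formula (1.17) with ζ₀ replaced by 1 − ζ₀, and Z
  by Ω˜_k"* as the same shape at generic data (`Eq117'`).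
* §2 — **(1.26)**: the boundary part `H″_{X₀,(Ω″˜_{h+1})ᶜ}` DEFINED as printed — *"We represent H″_{1,k,Z} as a sum of
  the first term and the sum of the remaining terms"* — i.e. as `H″_{1,k,Z} − H″_{1,k,X₀}` (`Hbd126`), whence (1.26)
  (`eq126`); its origin in the random-walk expansion (3.107) [13] as a `Prop` over an explicit (finite partial) family of
  walk terms with first term `H″_{1,k,X₀}` (`RW126`, with `Hbd126_eq_sum_erase` PROVED: the boundary part IS the sum of
  the remaining terms); and the sentence *"The decomposition yields the corresponding decomposition of the linear term in
  (1.20)"* PROVED (`linTerm120_split`: `g_k⟨DH″_{1,k,Z}B, ·⟩ = g_k⟨DH″_{1,k,X₀}B, ·⟩ + g_k⟨DH″_{X₀,(Ω″˜_{h+1})ᶜ}B, ·⟩` for the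
  linear functional `L` of `Sect1Data.Eq120`).
NOT HERE: the BOUNDS — the smallness of the last three terms of (1.17) (rows B16.Eq1.17 clause / B16.Eq1.47), the bound
(1.27) on the boundary part (row B16.Eq1.27, `…B16Sect1Statements.Ineq127`) and (1.28) — and the random-walk expansion
of [13] itself (rows of block B9: (3.107)–(3.108)); the convergence of (3.107) is not modelled (the family of walk terms
is an explicit finite partial family here, DIVERGENCE «schematic typing»).  No `sorry`, no axiom; nothing printed is
asserted as a fact: (1.17) and the (3.107)-origin of (1.26) are `def … : Prop`s, (1.26) itself is a definition, and
every identity that is algebra is a theorem.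

LABEL ERRATUM (v1.1, 2026-08-24; docstring-only — located by r09 gen 46, `lit-balaban-r13/INBOX.md` l.183; zero weight).
The tag «(174) [15]» used below for the expansion of the action around a background (`Expansion174`, `Expansion174.chain`,
`expansion174_of_repr`, `eq117_of_expansion174`, the binders `h174`) is, in [15] = [Balaban1985Variational]'s own
numbering, the functional **(41)** p. 284, *"A(U₀) + ⟨A, J⟩ + ½⟨A, Δ_πA⟩ + V₀(A)"* (= the expansion (26) p. 282 = (3.12)
[13]); [15]'s (174) p. 305 is the representation of the minimiser through `𝒜₁ + H₁B` (*"The function on the right-hand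
side of (174) is an analytic function of 𝒜₁ + H₁B"*).  The label was inherited from `…B12ActionExpansion26` v1.0
(p246376), corrected there by r09's v1.1 (p374484); p. 360 of this paper cites no [15] number at (1.17).  READ «(174)[15]»
BELOW AS «(41)/(26) [15]»; every declaration name, statement and proof is unchanged (mathematics unaffected).  Text layer
`paper:balaban1985-cmp102-variational-background` p0006 L11–14, p0008 L26–28, p0029 L31–34 re-read by r13 gen 104.
-/

open Set

namespace Literature.MathematicalPhysics.QuantumFieldTheory.Balaban1983to89.B16Eq117Expansion

open B16Sect1Wilson B16Sect1Backgrounds B16Sect1WilsonTerms B15DeterminingSets GaugeField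

variable {P : Params}

/-! ## §1. (1.17): the expansion of `A(ζ₀, U″_k)` with respect to `𝐇″_{k,Z}` -/

section Generic

variable {j : ℕ} {G : Type*} [GaugeGroup G] {𝔤 : Type*} [AddCommGroup 𝔤] [Module ℝ 𝔤]

/-- The SHAPE of an expansion of the localized Wilson action `A(ζ, ·)` around a base configuration `U` in the chart
`A ↦ (exp iηA)·U` — the first line of (2.6) [I] = (174) [15], verbatim [I] p. 266: *"A(exp iη𝐇_k(B′)U_{k+1}) = A(U_{k+1})
+ ⟨𝐇_k(B′), J_{k+1}⟩ + ½⟨𝐇_k(B′), Δ𝐇_k(B′)⟩ + V₀(𝐇_k(B′))"* — which p. 360 applies at `U = U″_{k,Z}`, weight `ζ₀`, to get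
(1.17), and p. 362 at `U = U⁰_{𝐁₁}`, weight `ζ`, to get (1.24): for the full configuration `W = (exp iηA)·U` (up to a gauge
transformation), `A(ζ, W) = A(ζ, (exp iηA)·U)` and `A(ζ, (exp iηA)·U) = A(ζ, U) + L A + ½Q A A + V₀ A` with EXPLICIT `L`
(linear), `Q` (bilinear), `V₀`.  (Label: «(174) [15]» in this file = (41)/(26) of [15] — module docstring, LABEL ERRATUM v1.1;
the name `Expansion174` is kept.) [cite: Balaban1987RG1, (2.6) p.266] -/
def Expansion174 (ch : ExpChart G 𝔤) (η : ℝ) (ζ : Plaq P j → ℝ) (W U : GaugeField P j G) (A : VecField P j 𝔤)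
    (L : VecField P j 𝔤 →ₗ[ℝ] ℝ) (Q : VecField P j 𝔤 →ₗ[ℝ] VecField P j 𝔤 →ₗ[ℝ] ℝ) (V₀ : VecField P j 𝔤 → ℝ) : Prop :=
  wilsonLoc ζ W = wilsonLoc ζ (expMul ch (η • A) U) ∧
    wilsonLoc ζ (expMul ch (η • A) U) = wilsonLoc ζ U + L A + 1 / 2 * Q A A + V₀ A

/-- The two members of `Expansion174` chain to `A(ζ, W) = A(ζ, U) + L A + ½Q A A + V₀ A`. Bookkeeping. [cite: Balaban1989LargeFieldII, (1.17) p.360] -/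
theorem Expansion174.chain {ch : ExpChart G 𝔤} {η : ℝ} {ζ : Plaq P j → ℝ} {W U : GaugeField P j G}
    {A : VecField P j 𝔤} {L : VecField P j 𝔤 →ₗ[ℝ] ℝ} {Q : VecField P j 𝔤 →ₗ[ℝ] VecField P j 𝔤 →ₗ[ℝ] ℝ}
    {V₀ : VecField P j 𝔤 → ℝ} (h : Expansion174 ch η ζ W U A L Q V₀) :
    wilsonLoc ζ W = wilsonLoc ζ U + L A + 1 / 2 * Q A A + V₀ A :=
  h.1.trans h.2

/-- If the full configuration IS a gauge transform of `(exp iηA)·U` (the representations (1.16), (1.19), (1.22), (1.36)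
all have this form) and the (174)[15]-expansion of `A(ζ, ·)` around `U` holds at the field `A`, then `Expansion174`
holds — gauge invariance of `A(ζ, ·)` (`…B16Sect1WilsonTerms.wilsonLoc_gaugeAct`). PROVED. [cite: Balaban1989LargeFieldII, (1.17) p.360] -/
theorem expansion174_of_repr {ch : ExpChart G 𝔤} {η : ℝ} {ζ : Plaq P j → ℝ} {W U : GaugeField P j G}
    {A : VecField P j 𝔤} {L : VecField P j 𝔤 →ₗ[ℝ] ℝ} {Q : VecField P j 𝔤 →ₗ[ℝ] VecField P j 𝔤 →ₗ[ℝ] ℝ}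
    {V₀ : VecField P j 𝔤 → ℝ} (u : GaugeTransf P j G) (hrepr : W = gaugeAct u (expMul ch (η • A) U))
    (h174 : wilsonLoc ζ (expMul ch (η • A) U) = wilsonLoc ζ U + L A + 1 / 2 * Q A A + V₀ A) :
    Expansion174 ch η ζ W U A L Q V₀ :=
  ⟨by rw [hrepr, wilsonLoc_gaugeAct], h174⟩

end Generic

namespace Sect1Data

noncomputable section

variable {G : Type*} [GaugeGroup G] {av : ∀ i, Averaging P i G} {𝔤 : Type*} [AddCommGroup 𝔤] [Module ℝ 𝔤]
variable (D : Sect1Data P G av 𝔤)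

/-- **(1.17)** p. 360 [PDF 6], verbatim: *"We expand the first term on the right-hand side of (1.15) with respect to the
function 𝐇″_{k,Z}: A(ζ₀, U″_k) = A(ζ₀, exp iη𝐇″_{k,Z}U″_{k,Z}) = A(ζ₀, U″_{k,Z}) + ⟨D𝐇″_{k,Z}, ζ₀η⁻² Im ∂U″_{k,Z}⟩
+ ½⟨𝐇″_{k,Z}, Δ(ζ₀)𝐇″_{k,Z}⟩ + V₀(ζ₀, 𝐇″_{k,Z}). (1.17)"* (here `𝐇″_{k,Z}` abbreviates the value of that function at
the argument of (1.16), *"(1/i) log[M˙(U″_k)(M˙(Q_k^{s*}V_k))⁻¹]↾_{Z∖Z˜⁻¹}"* = `arg116`) — over the configurations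
`U″_k = cfgPP`, `U″_{k,Z} = cfgPPZ` of (1.16), a representing function `H = 𝐇″_{k,Z}` (row B16.Eq1.16, `Repr116`), and the
EXPLICIT expansion data at the background `U″_{k,Z}` and weight `ζ₀`: `L A = ⟨DA, ζ₀η⁻² Im ∂U″_{k,Z}⟩` (linear),
`Q A A′ = ⟨A, Δ(ζ₀)A′⟩` (bilinear), `V₀ = V₀(ζ₀, ·)`.  The two printed equalities. [cite: Balaban1989LargeFieldII, (1.17) p.360] -/
def Eq117 (ζ₀ : Plaq P 0 → ℝ) (H : MSVecField P 𝔤 → VecField P 0 𝔤) (L : VecField P 0 𝔤 →ₗ[ℝ] ℝ)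
    (Q : VecField P 0 𝔤 →ₗ[ℝ] VecField P 0 𝔤 →ₗ[ℝ] ℝ) (V₀ : VecField P 0 𝔤 → ℝ) : Prop :=
  Expansion174 D.ch D.η ζ₀ D.cfgPP D.cfgPPZ (H D.arg116) L Q V₀

/-- (1.17) unfolded: `A(ζ₀, U″_k) = A(ζ₀, exp iη𝐇″_{k,Z}(arg116)·U″_{k,Z})` and `A(ζ₀, exp iη𝐇″_{k,Z}(arg116)·U″_{k,Z}) =
A(ζ₀, U″_{k,Z}) + L(𝐇″) + ½Q(𝐇″, 𝐇″) + V₀(𝐇″)`. [cite: Balaban1989LargeFieldII, (1.17) p.360] -/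
theorem eq117_iff (ζ₀ : Plaq P 0 → ℝ) (H : MSVecField P 𝔤 → VecField P 0 𝔤) (L : VecField P 0 𝔤 →ₗ[ℝ] ℝ)
    (Q : VecField P 0 𝔤 →ₗ[ℝ] VecField P 0 𝔤 →ₗ[ℝ] ℝ) (V₀ : VecField P 0 𝔤 → ℝ) :
    Eq117 D ζ₀ H L Q V₀ ↔
      wilsonLoc ζ₀ D.cfgPP = wilsonLoc ζ₀ (expMul D.ch (D.η • H D.arg116) D.cfgPPZ) ∧
        wilsonLoc ζ₀ (expMul D.ch (D.η • H D.arg116) D.cfgPPZ) =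
          wilsonLoc ζ₀ D.cfgPPZ + L (H D.arg116) + 1 / 2 * Q (H D.arg116) (H D.arg116) + V₀ (H D.arg116) :=
  Iff.rfl

/-- (1.17), FIRST EQUALITY, PROVED: the representation (1.16) `U″_k = (exp iη𝐇″_{k,Z}(arg116)·U″_{k,Z})^{u″⁻¹}` (`Repr116`)
and gauge invariance of `A(ζ₀, ·)` give `A(ζ₀, U″_k) = A(ζ₀, exp iη𝐇″_{k,Z}(arg116)·U″_{k,Z})`. [cite: Balaban1989LargeFieldII, (1.17) p.360] -/
theorem eq117_first {H : MSVecField P 𝔤 → VecField P 0 𝔤} {u : MSVecField P 𝔤 → GaugeTransf P 0 G}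
    (h116 : D.Repr116 H u) (ζ₀ : Plaq P 0 → ℝ) :
    wilsonLoc ζ₀ D.cfgPP = wilsonLoc ζ₀ (expMul D.ch (D.η • H D.arg116) D.cfgPPZ) := by
  rw [h116, wilsonLoc_gaugeAct]

/-- (1.17) PROVED from its two printed inputs: the representation (1.16) (`Repr116`) and the (174)[15] = (2.6)[I]
(first line) expansion of `A(ζ₀, ·)` around `U″_{k,Z}` at the field `𝐇″_{k,Z}(arg116)` (`h174`, the functionals `L`,
`Q`, `V₀` being those of that expansion). [cite: Balaban1989LargeFieldII, (1.17) p.360] -/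
theorem eq117_of_expansion174 {H : MSVecField P 𝔤 → VecField P 0 𝔤} {u : MSVecField P 𝔤 → GaugeTransf P 0 G}
    (h116 : D.Repr116 H u) (ζ₀ : Plaq P 0 → ℝ) {L : VecField P 0 𝔤 →ₗ[ℝ] ℝ}
    {Q : VecField P 0 𝔤 →ₗ[ℝ] VecField P 0 𝔤 →ₗ[ℝ] ℝ} {V₀ : VecField P 0 𝔤 → ℝ}
    (h174 : wilsonLoc ζ₀ (expMul D.ch (D.η • H D.arg116) D.cfgPPZ) =
      wilsonLoc ζ₀ D.cfgPPZ + L (H D.arg116) + 1 / 2 * Q (H D.arg116) (H D.arg116) + V₀ (H D.arg116)) :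
    Eq117 D ζ₀ H L Q V₀ :=
  expansion174_of_repr (invG (u D.arg116)) h116 h174

/-- (1.17) chained: `A(ζ₀, U″_k) = A(ζ₀, U″_{k,Z}) + ⟨D𝐇″, ζ₀η⁻²Im ∂U″_{k,Z}⟩ + ½⟨𝐇″, Δ(ζ₀)𝐇″⟩ + V₀(ζ₀, 𝐇″)` — the form in which
(1.17) enters the summary (1.32) (the hypothesis `h17` of `…B16Sect1WilsonTerms.eq132_chain`, with `t17 = L 𝐇″ + ½Q 𝐇″ 𝐇″
+ V₀ 𝐇″`). [cite: Balaban1989LargeFieldII, (1.17) p.360] -/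
theorem eq117_chain {ζ₀ : Plaq P 0 → ℝ} {H : MSVecField P 𝔤 → VecField P 0 𝔤} {L : VecField P 0 𝔤 →ₗ[ℝ] ℝ}
    {Q : VecField P 0 𝔤 →ₗ[ℝ] VecField P 0 𝔤 →ₗ[ℝ] ℝ} {V₀ : VecField P 0 𝔤 → ℝ} (h : Eq117 D ζ₀ H L Q V₀) :
    wilsonLoc ζ₀ D.cfgPP =
      wilsonLoc ζ₀ D.cfgPPZ + (L (H D.arg116) + 1 / 2 * Q (H D.arg116) (H D.arg116) + V₀ (H D.arg116)) := by
  rw [Expansion174.chain h]; ring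

end

end Sect1Data

section SecondTerm

variable {G : Type*} [GaugeGroup G] {𝔤 : Type*} [AddCommGroup 𝔤] [Module ℝ 𝔤]

/-- **(1.17) for the second term of (1.15)** p. 360 [PDF 6], verbatim: *"The second term on the right-hand side of (1.15)
is represented in a similar way. We apply (1.16) with Z replaced by Ω˜_k, and Z∖Z˜⁻¹ replaced by Ω˜_k∖Ω_k, and then the
formula (1.17) with ζ₀ replaced by 1 − ζ₀, and Z by Ω˜_k. The last three terms in this expansion are also small for the
same reason"* — the same shape at the weight `1 − ζ₀`, for the localized configuration `U″_{k,Ω˜_k}` (`UΩ`), the chart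
field `𝐇″_{k,Ω˜_k}((1/i) log[…]↾_{Ω˜_k∖Ω_k})` (`A`) and the expansion data at `U″_{k,Ω˜_k}` (all explicit arguments; the
`Ω˜_k`-localized configuration is not a field of `Sect1Data`). This is the hypothesis `h17'` of
`…B16Sect1WilsonTerms.eq132_chain`. [cite: Balaban1989LargeFieldII, (1.17) p.360] -/
def Eq117' (ch : ExpChart G 𝔤) (η : ℝ) (ζ₀ : Plaq P 0 → ℝ) (Upp UΩ : GaugeField P 0 G) (A : VecField P 0 𝔤)
    (L : VecField P 0 𝔤 →ₗ[ℝ] ℝ) (Q : VecField P 0 𝔤 →ₗ[ℝ] VecField P 0 𝔤 →ₗ[ℝ] ℝ) (V₀ : VecField P 0 𝔤 → ℝ) : Prop :=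
  Expansion174 ch η (fun p => 1 - ζ₀ p) Upp UΩ A L Q V₀

/-- With (1.17) and its `1 − ζ₀` twin, the splitting (1.15) `A(U″_k) = A(ζ₀, U″_k) + A(1 − ζ₀, U″_k)` (tree theorem
`…B16Sect1Wilson.eq115`) becomes `A(U″_k) = A(ζ₀, U″_{k,Z}) + A(1 − ζ₀, U″_{k,Ω˜_k}) + (the six expansion terms)` — the
form consumed by (1.32). PROVED (bookkeeping). [cite: Balaban1989LargeFieldII, (1.17) p.360] -/
theorem eq115_expanded {ch : ExpChart G 𝔤} {η : ℝ} {ζ₀ : Plaq P 0 → ℝ} {Upp UZ UΩ : GaugeField P 0 G}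
    {A A' : VecField P 0 𝔤} {L L' : VecField P 0 𝔤 →ₗ[ℝ] ℝ} {Q Q' : VecField P 0 𝔤 →ₗ[ℝ] VecField P 0 𝔤 →ₗ[ℝ] ℝ}
    {V₀ V₀' : VecField P 0 𝔤 → ℝ} (h17 : Expansion174 ch η ζ₀ Upp UZ A L Q V₀)
    (h17' : Eq117' ch η ζ₀ Upp UΩ A' L' Q' V₀') :
    wilsonAction4 Upp =
      wilsonLoc ζ₀ UZ + wilsonLoc (fun p => 1 - ζ₀ p) UΩ +
        ((L A + 1 / 2 * Q A A + V₀ A) + (L' A' + 1 / 2 * Q' A' A' + V₀' A')) := by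
  rw [eq115 ζ₀ Upp, Expansion174.chain h17, Expansion174.chain h17']
  ring

end SecondTerm

/-! ## §2. (1.26): the splitting of the minimizer `H″_{1,k,Z}` and of the linear term of (1.20) -/

section Eq126

variable {M V : Type*} [AddCommGroup M] [Module ℝ M] [AddCommGroup V] [Module ℝ V]

/-- The BOUNDARY PART `H″_{X₀,(Ω″˜_{h+1})ᶜ}` of the minimizer, DEFINED as printed, p. 362 [PDF 8]: *"The remaining terms
correspond to walks intersecting (Ω″˜_{h+1})ᶜ … We represent H″_{1,k,Z} as a sum of the first term and the sum of the
remaining terms"* — the sum of the remaining terms is the whole minus the first term `H″_{1,k,X₀}` (linear operators from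
the chart fields `B` on `𝐁₀` to vector fields on the fine lattice; `M`, `V` the two ℝ-modules).
[cite: Balaban1989LargeFieldII, (1.26) p.362] -/
def Hbd126 (H1kZ H1kX0 : M →ₗ[ℝ] V) : M →ₗ[ℝ] V := H1kZ - H1kX0

/-- **(1.26)** p. 362 [PDF 8], verbatim: *"We represent H″_{1,k,Z} as a sum of the first term and the sum of the remaining
terms: H″_{1,k,Z} = H″_{1,k,X₀} + H″_{X₀,(Ω″˜_{h+1})ᶜ}. (1.26)"* — PROVED (definitional, `Hbd126`). [cite: Balaban1989LargeFieldII, (1.26) p.362] -/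
theorem eq126 (H1kZ H1kX0 : M →ₗ[ℝ] V) : H1kZ = H1kX0 + Hbd126 H1kZ H1kX0 := by
  simp [Hbd126]

/-- (1.26) applied to a field `B`. [cite: Balaban1989LargeFieldII, (1.26) p.362] -/
theorem eq126_apply (H1kZ H1kX0 : M →ₗ[ℝ] V) (B : M) : H1kZ B = H1kX0 B + Hbd126 H1kZ H1kX0 B := by
  simp [Hbd126]

/-- The ORIGIN of (1.26) in the generalized random-walk expansion, p. 362 [PDF 8], verbatim: *"At first we localize the
minimizer H″_{1,k,Z}. We construct the generalized random walk expansion for it, including Z∩Ω″˜_{h+1} as one of the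
localization domains X, see Sect. C [13] for details. … The expansion has the form (3.107) [13], where X₀ = Z∩Ω″˜_{h+1},
and the terms of the expansion satisfy (3.108) [13]. … hence the first term of the expansion corresponds to the walk
(0, X₀), and is given by the function H″_{1,k,X₀}. The remaining terms correspond to walks intersecting (Ω″˜_{h+1})ᶜ"* —
as a `Prop` over an EXPLICIT family of walk terms `T ω` indexed by a finite set of walks containing the trivial walk
`ω₀ = (0, X₀)`: the minimizer is the sum of the terms and the `ω₀`-term is `H″_{1,k,X₀}` (the expansion (3.107) [13] is a
convergent series; a finite partial family stands for it here — DIVERGENCE «schematic typing»; its terms and the bound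
(3.108) are rows of block B9). [cite: Balaban1989LargeFieldII, (1.26) p.362] -/
def RW126 {Ω : Type*} (walks : Finset Ω) (T : Ω → (M →ₗ[ℝ] V)) (ω₀ : Ω) (H1kZ H1kX0 : M →ₗ[ℝ] V) : Prop :=
  ω₀ ∈ walks ∧ H1kZ = ∑ ω ∈ walks, T ω ∧ T ω₀ = H1kX0

/-- Under the random-walk origin `RW126`, the boundary part `Hbd126` IS *"the sum of the remaining terms"* — the terms of
the walks other than `(0, X₀)`. PROVED. [cite: Balaban1989LargeFieldII, (1.26) p.362] -/
theorem Hbd126_eq_sum_erase {Ω : Type*} [DecidableEq Ω] {walks : Finset Ω} {T : Ω → (M →ₗ[ℝ] V)} {ω₀ : Ω}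
    {H1kZ H1kX0 : M →ₗ[ℝ] V} (h : RW126 walks T ω₀ H1kZ H1kX0) :
    Hbd126 H1kZ H1kX0 = ∑ ω ∈ walks.erase ω₀, T ω := by
  obtain ⟨hω₀, hsum, hfirst⟩ := h
  rw [Hbd126, hsum, ← hfirst, ← Finset.add_sum_erase walks T hω₀]
  abel

/-- *"The decomposition yields the corresponding decomposition of the linear term in (1.20)."* (p. 362, after (1.26)) —
for the linear functional `L A = ⟨DA, ζη⁻² Im ∂U⁰_{k,Z}⟩` of (1.20) (`…B16Sect1WilsonTerms.Sect1Data.Eq120`):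
`g_k⟨DH″_{1,k,Z}B, ζη⁻²Im ∂U⁰_{k,Z}⟩ = g_k⟨DH″_{1,k,X₀}B, …⟩ + g_k⟨DH″_{X₀,(Ω″˜_{h+1})ᶜ}B, …⟩` — the second summand is the term
bounded through (1.27), the first is (1.28). PROVED (linearity). [cite: Balaban1989LargeFieldII, (1.26) p.362] -/
theorem linTerm120_split (L : V →ₗ[ℝ] ℝ) (H1kZ H1kX0 : M →ₗ[ℝ] V) (gk : ℝ) (B : M) :
    gk * L (H1kZ B) = gk * L (H1kX0 B) + gk * L (Hbd126 H1kZ H1kX0 B) := by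
  rw [eq126_apply H1kZ H1kX0 B, map_add, mul_add]

end Eq126

end Literature.MathematicalPhysics.QuantumFieldTheory.Balaban1983to89.B16Eq117Expansion
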